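import Literature.AlgebraicGeometry.ComplexMultiplication.CMTorusHomSpacesOfTwoTypes
import Literature.AlgebraicGeometry.HodgeTheory.CMBettiModel
import Literature.AlgebraicGeometry.HodgeTheory.AbelianVarietyHOneHodgeHomSpaces
import Literature.AlgebraicGeometry.HodgeTheory.BettiOneHodgeStructureModelIndependence
import HarnessLib

/-!
# The `Hom` groups of two CM abelian varieties: `rk_ℤ Hom(A₀, A₁)` is the number of compatible pairs of
# embeddings of the two CM types (Riemann's theorem ∘ `V¹_{(K,Φ)} = H¹_B(A)` ∘ the character count)

Topic `Literature/AlgebraicGeometry/ComplexMultiplication` (family `hodge`, lane `lit-hodgefound`, Layer A3 «CM abelian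
varieties» on the ALGEBRAIC carrier `Motives.AbelianVariety ℂ`), namespace
`Literature.AlgebraicGeometry.ComplexMultiplication` (dot-lemmas on `IsCMTypeRealisation`).  Sequel of
`HodgeTheory/AbelianVarietyHOneHodgeHomSpaces` (Riemann's theorem, Deligne–Milne 1982 Thm. 6.20, numerically:
`finrank_hom_bettiOne_eq : dim_ℚ Hom_{Hod_ℚ}(H¹_B(A'), H¹_B(A)) = rk_ℤ Hom(A, A')`, a THEOREM of the tree), of
`HodgeTheory/CMBettiModel` (Green–Griffiths–Kerr §V.B «`V¹_{(K,Σ)} = H¹(A^{(K,Σ)}_𝔞)` as `ℚ`-Hodge structures»: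
`CMBettiModel.ofCMType_eq_comapEquiv`, on the universe avatar `BettiUniverse.hodge`), of
`HodgeTheory/BettiOneHodgeStructureModelIndependence` (`bettiOneHodgeStructure_eq_cast_hodge`: the record avatar
`bettiOneHodgeStructure A B hB` of Thm. 6.20 IS the universe avatar) and of `Motives/HodgeStructureOfCMTypeHomSpaces` /
`ComplexMultiplication/CMTorusHomSpacesOfTwoTypes` (the character count
`dim_ℚ Hom_{ℚ-HS}(V¹_{(K₁,Φ₁)}, V¹_{(K₀,Φ₀)}) = #{(s,t) | ∀ τ ∈ Aut(ℂ), τs ∈ Φ₀ ⟺ τt ∈ Φ₁}` and the transport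
`Hom.finrank_eq_of_comp_eq_id`).

SOURCES.  P. Deligne, J. S. Milne, *Tannakian Categories*, LNM 900 (1982) [DeligneMilne1982Tannakian] II §6 Thm. 6.20
p. 212 («(Riemann) The functor `H¹_B : Isab_ℂ → Hod_ℚ` is fully faithful», so `Hom(A, A') ⊗ ℚ ≅ Hom_{Hod_ℚ}(H¹_B(A'),
H¹_B(A))`); M. Green, P. Griffiths, M. Kerr [GreenGriffithsKerr2012] §V.B p. 160 («`V¹_{(K,Σ)} = H¹(A^{(K,Σ)}_𝔞)` as
`ℚ`-Hodge structures, independently of `𝔞`»); P. Deligne [Deligne1982HodgeCycles] Example 3.7 and §5; J. S. Milne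
[MilneCM2006] Ch. I §5 Prop. 5.2 (CM Hodge structures ≃ representations of the Serre group: `Hom` spaces of CM Hodge
structures are multiplicity pairings of characters — the count below), §3 Props. 3.12–3.13 (classification up to
isogeny by CM types); G. Shimura [Shimura1998] §5.1 Props. 4, 6, §5.2 pp. 36–39 («`[F : ℚ] = 2n`»), §6.1 Cor. of
Thm. 2, §6.2 Thm. 3; H. Lange [Lange2023AbelianVarietiesComplex] §1.1.2 Prop. 1.1.8 («`Hom(X, X') ≃ ℤ^m`»), §2.4.4
Cor. 2.4.26; D. Mumford [MumfordAV1970] §19 Thm. 3 and Cor. 1 (`Hom` is free of finite rank; `End⁰ = ℚ ⊗ End`).  The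
number `#C(Φ₀, Φ₁)` is not printed in this form in the sources held; it is DERIVED here from the cited theorems exactly
as the sources derive their evaluations (Milne Prop. 5.2: `Hom_{Hod}(V_{Φ₁}, V_{Φ₀}) = Hom_S(ρ_{Φ₁}, ρ_{Φ₀})`, whose
dimension is the number of pairs of weights `(s, t)` with one `Aut(ℂ)`-orbit pattern — the Galois descent of
`Motives/HodgeStructureOfCMTypeHomSpaces`).

WHAT IS PROVED (theorems only; NO definition, NO named fact — D-0026 net Literature debt 0; every hypothesis of the cited
tree theorems that is itself a theorem of the tree — `exists_isReal_hodgeModel_holds`,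
`hodgePQ_independent_of_hodgeModel_holds`, `AbelianVariety.isSmoothProjective_holds`, Riemann's theorem
`deligneMilne1982_Thm_6_20_full_holds` inside `finrank_hom_bettiOne_eq` — is discharged, so the statements are
UNCONDITIONAL).  For realisations `(A, ι, θ)` of `(K; Φ)`, `(A₀, ι₀, θ₀)` of `(K₀; Φ₀)`, `(A₁, ι₁, θ₁)` of `(K₁; Φ₁)` read
on `H¹` (`IsCMTypeRealisation`, `ComplexMultiplication/ShimuraIsogeny`; ANY number fields, no CM-field hypothesis is
used), and the set of COMPATIBLE PAIRS
`C(Φ₀, Φ₁) = {(s,t) ∈ Hom(K₀,ℂ) × Hom(K₁,ℂ) | ∀ τ ∈ Aut(ℂ), τ ∘ s ∈ Φ₀ ⟺ τ ∘ t ∈ Φ₁}`: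
* §1 (junction, GGK §V.B on the record carrier) `IsCMTypeRealisation.ofCMType_eq_comapEquiv_bettiOne` — EVERY
  `K`-equivariant `e : K ≃ₗ[ℚ] H¹(A(ℂ); ℚ)` is an isomorphism of Hodge structures
  `V¹_{(K,Φ)} = e^* H¹_B(A)`: `ofCMType Φ = (bettiOneHodgeStructure A B hB).comapEquiv e` for ANY Hodge-symmetric model
  `B` (the dimension index `[K:ℚ]/2` of the realisation and `dim A` of the record agree by `[K:ℚ] = 2 dim A`, and the
  weights `((1 : ℕ) : ℤ)` / `1` by `bettiOneHodgeStructure_eq_cast_hodge`); `exists_ofCMType_eq_comapEquiv_bettiOne`;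
  `exists_hom_ofCMType_bettiOne` (mutually inverse morphisms of Hodge structures `V¹_Φ ⇄ H¹_B(A)`, the first bijective
  and `K`-equivariant).
* §2 (two types) `finrank_hom_bettiOne_eq_finrank_hom_ofCMType`
  (`dim Hom_{Hod}(H¹_B(A₁), H¹_B(A₀)) = dim Hom_{ℚ-HS}(V¹_{Φ₁}, V¹_{Φ₀})`), `finrank_hom_bettiOne_eq_ncard`, and
  **`IsCMTypeRealisation.finrank_hom_eq_ncard : Module.finrank ℤ (A₀ ⟶ A₁) = #C(Φ₀, Φ₁)`**, with
  `finrank_rat_tensor_hom_eq_ncard` (`dim_ℚ Hom⁰(A₀, A₁) = #C`), `finrank_hom_comm` (`rk Hom(A₀, A₁) = rk Hom(A₁, A₀)`),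
  **`forall_hom_eq_zero_iff`** (`Hom(A₀, A₁) = 0 ⟺ C(Φ₀, Φ₁) = ∅`), `exists_forall_comp_mem_iff_of_isIsogenous`
  (isogenous CM abelian varieties have a compatible pair) / `not_isIsogenous_of_forall`; §2′ the torus junction
  `finrank_hom_eq_finrank_homRat_periodEquiv` (`rk_ℤ Hom(A₀, A₁) = rk Hom_ℚ(ℂ^{Φ₀}/u(𝔪₀), ℂ^{Φ₁}/u(𝔪₁))` for any
  lattices — both are `#C`).
* §3 (one type) **`finrank_end_eq_ncard`** (`rk_ℤ End(A) = #C(Φ, Φ)`), `finrank_endAlgebra_eq_ncard`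
  (`dim_ℚ End⁰(A) = #C(Φ, Φ)`), `finrank_le_finrank_hom` (two realisations of ONE type: `[K:ℚ] ≤ rk Hom(A, A')` — in
  particular `Hom(A, A') ≠ 0`, the numerical shadow of Shimura §6.1 Cor.), `finrank_le_finrank_end` /
  `two_mul_dim_le_finrank_end` (`2 dim A = [K:ℚ] ≤ rk End(A)`: `A` has complex multiplication in the rank sense),
  `finrank_le_finrank_endAlgebra`, `finrank_end_eq_two_of_finrank_eq_two` and the validation
  `finrank_end_eq_two_of_dim_eq_one` (a CM elliptic curve has `rk_ℤ End(E) = 2`).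

NOT HERE: the evaluation of `#C` for induced / primitive types (`= [K:K₀]·[K:ℚ]`, the tree's
`IsCMTypeRealisation.finrank_endAlgebra_of_inducedCMType`, torus-of-record route — consistent by name, not imported), the
algebra structure of `End⁰(A)`, isogeny DECISIONS (Shimura §6.1 Cor. is the tree's `Shimura1998_Thm2_Cor`).

## Provenance
Lane `lit-hodgefound`, prover seat `lit-hodgefound-p29` (generation 12), self-proposed row g12-#2 (lane INBOX claim
2026-08-23T09:57:51Z).

## References
* [DeligneMilne1982Tannakian] P. Deligne, J. S. Milne, *Tannakian Categories*, LNM 900 (1982) — II §6 Thm. 6.20 (p. 212).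
* [GreenGriffithsKerr2012] M. Green, P. Griffiths, M. Kerr, *Mumford–Tate Groups and Domains*, Ann. of Math. Stud. 183
  (2012) — §V.B p. 160, §V.C.
* [Deligne1982HodgeCycles] P. Deligne, *Hodge cycles on abelian varieties*, LNM 900 (1982) — Example 3.7, §5.
* [DeligneHodgeII1971] P. Deligne, *Théorie de Hodge II* — 2.1, Thm. 2.3.5.
* [MilneCM2006] J. S. Milne, *Complex Multiplication* (2006) — Ch. I §3 (3.11), Props. 3.12–3.13, §5 Prop. 5.2.
* [Shimura1998] G. Shimura, *Abelian Varieties with Complex Multiplication and Modular Functions* (1998) — §5.1 Props. 4,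
  6, §5.2 pp. 36–39, §6.1 Thm. 2 Cor., §6.2 Thm. 3.
* [Lange2023AbelianVarietiesComplex] H. Lange, *Abelian Varieties over the Complex Numbers* (2023) — §1.1.2 Prop. 1.1.8,
  §2.4.4 Cor. 2.4.26.
* [MumfordAV1970] D. Mumford, *Abelian Varieties* (1970) — §19 Thm. 3, Cor. 1–2.
-/

noncomputable section

open scoped TensorProduct
open NumberField CategoryTheory Module

namespace Literature.AlgebraicGeometry.ComplexMultiplication

open Literature.AlgebraicGeometry.Motives (CMType HodgeStructure AbelianVariety bettiCohomology IsSmoothProjective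
  SchemeOver)
open Literature.AlgebraicGeometry.Motives.HodgeStructure (ofCMType Hom)
open Literature.AlgebraicGeometry.HodgeTheory
open Literature.AlgebraicGeometry.HodgeTheory.BettiUniverse (cmAction)

/-! ## §1 The junction `V¹_{(K,Φ)} = e^* H¹_B(A)` on the record carrier `bettiOneHodgeStructure` -/

section Junction

variable {K : Type} [Field K] [NumberField K] {Φ : CMType K} {A : AbelianVariety ℂ} {ι : 𝓞 K →+* End A}
  {θ : K →+* Module.End ℂ (complexBetti A.X 1)}

/-- The universe avatar `BettiUniverse.hodge hHD hX k` does not depend on the dimension index `n` of the witness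
`hX : IsSmoothProjective n X` (two indices for one `X` are equal, and the structure is read in the chosen real model).
[folklore] -/
private theorem hodge_congr {X : SchemeOver ℂ} {n m : ℕ} (hHD : exists_isReal_hodgeModel)
    (hn : IsSmoothProjective n X) (hm : IsSmoothProjective m X) (hnm : n = m) (k : ℕ) :
    BettiUniverse.hodge hHD hn k = BettiUniverse.hodge hHD hm k := by
  subst hnm
  rfl

/-- **`V¹_{(K,Φ)} = e^* H¹_B(A)` (Green–Griffiths–Kerr §V.B) on the record carrier of Deligne–Milne 6.20**: for a
realisation `(A, ι, θ)` of `(K; Φ)` read on `H¹`, EVERY `K`-equivariant `ℚ`-linear isomorphism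
`e : K ≃ H¹(A(ℂ); ℚ)` is an isomorphism of Hodge structures from `HodgeStructure.ofCMType Φ` to `H¹_B(A)` read in ANY
Hodge-symmetric model `B` — `ofCMType Φ = (bettiOneHodgeStructure A B hB).comapEquiv e` (the tree's
`CMBettiModel.ofCMType_eq_comapEquiv` on `BettiUniverse.hodge`, whose dimension index `[K:ℚ]/2` is `dim A` by
`[K:ℚ] = dim H¹ = 2 dim A`, and `bettiOneHodgeStructure_eq_cast_hodge`). [cite: GreenGriffithsKerr2012, §V.B p. 160]
[cite: Deligne1982HodgeCycles, Example 3.7 and §5] [cite: Shimura1998, §5.2 pp. 36–37] -/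
theorem IsCMTypeRealisation.ofCMType_eq_comapEquiv_bettiOne (h : IsCMTypeRealisation Φ A ι θ)
    (B : HodgeModel A.dim A.X) (hB : B.IsHodgeSymmetric) (e : K ≃ₗ[ℚ] bettiCohomology A.X 1)
    (he : ∀ k x, e (k * x) = cmAction θ h.isInducedOnIntegers k (e x)) :
    ofCMType Φ = (bettiOneHodgeStructure A B hB).comapEquiv e := by
  have hdim : Module.finrank ℚ K / 2 = A.dim := by
    have h₁ := BettiUniverse.finrank_bettiCohomology_one_eq h.1 h.2.1
    rw [finrank_bettiCohomology_one A] at h₁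
    omega
  rw [CMBettiModel.ofCMType_eq_comapEquiv h exists_isReal_hodgeModel_holds hodgePQ_independent_of_hodgeModel_holds
      e he,
    bettiOneHodgeStructure_eq_cast_hodge exists_isReal_hodgeModel_holds hodgePQ_independent_of_hodgeModel_holds A B
      hB Motives.AbelianVariety.isSmoothProjective_holds,
    hodge_congr exists_isReal_hodgeModel_holds h.1 Motives.AbelianVariety.isSmoothProjective_holds hdim 1]
  apply HodgeStructure.ext
  funext p
  rw [HodgeStructure.comapEquiv_F, HodgeStructure.comapEquiv_F, HodgeStructure.cast_F]

/-- **`V¹_{(K,Φ)} ≅ H¹_B(A)` for every realisation**: a `K`-equivariant `e : K ≃ H¹(A(ℂ); ℚ)` with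
`ofCMType Φ = (bettiOneHodgeStructure A B hB).comapEquiv e` EXISTS («independently of `𝔞`»).
[cite: GreenGriffithsKerr2012, §V.B p. 160] [cite: Shimura1998, §6.2 Theorem 3] -/
theorem IsCMTypeRealisation.exists_ofCMType_eq_comapEquiv_bettiOne (h : IsCMTypeRealisation Φ A ι θ)
    (B : HodgeModel A.dim A.X) (hB : B.IsHodgeSymmetric) :
    ∃ e : K ≃ₗ[ℚ] bettiCohomology A.X 1,
      (∀ k x, e (k * x) = cmAction θ h.isInducedOnIntegers k (e x)) ∧
        ofCMType Φ = (bettiOneHodgeStructure A B hB).comapEquiv e := by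
  obtain ⟨e, he, -⟩ :=
    CMBettiModel.exists_ofCMType_eq_comapEquiv h exists_isReal_hodgeModel_holds hodgePQ_independent_of_hodgeModel_holds
  exact ⟨e, he, h.ofCMType_eq_comapEquiv_bettiOne B hB e he⟩

/-- **Mutually inverse morphisms of Hodge structures `V¹_{(K,Φ)} ⇄ H¹_B(A)`** (`e` and `e⁻¹`; the first is bijective
and `K`-equivariant for the rational CM action `BettiUniverse.cmAction`). [cite: GreenGriffithsKerr2012, §V.B p. 160]
[cite: DeligneHodgeII1971, 2.1] -/
theorem IsCMTypeRealisation.exists_hom_ofCMType_bettiOne (h : IsCMTypeRealisation Φ A ι θ)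
    (B : HodgeModel A.dim A.X) (hB : B.IsHodgeSymmetric) :
    ∃ (f : Hom (ofCMType Φ) (bettiOneHodgeStructure A B hB)) (g : Hom (bettiOneHodgeStructure A B hB) (ofCMType Φ)),
      g.comp f = HodgeStructure.Hom.id _ ∧ f.comp g = HodgeStructure.Hom.id _ ∧
        Function.Bijective f.toLinearMap ∧
          ∀ k x, f.toLinearMap (k * x) = cmAction θ h.isInducedOnIntegers k (f.toLinearMap x) := by
  obtain ⟨e, he, hΦ⟩ := h.exists_ofCMType_eq_comapEquiv_bettiOne B hB
  rw [hΦ]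
  exact ⟨⟨e.toLinearMap, fun p => by
      rintro _ ⟨x, hx, rfl⟩
      exact hx⟩,
    ⟨e.symm.toLinearMap, fun p => by
      rintro _ ⟨y, hy, rfl⟩
      simp only [HodgeStructure.comapEquiv_F, Submodule.mem_comap,
        HodgeStructure.baseChange_apply_symm_baseChange]
      exact hy⟩,
    HodgeStructure.Hom.ext (LinearMap.ext fun v => e.symm_apply_apply v),
    HodgeStructure.Hom.ext (LinearMap.ext fun w => e.apply_symm_apply w), e.bijective, he⟩

end Junction

/-! ## §2 Two types: `rk_ℤ Hom(A₀, A₁) = dim Hom_{Hod}(H¹_B(A₁), H¹_B(A₀)) = dim Hom_{ℚ-HS}(V¹_{Φ₁}, V¹_{Φ₀}) = #C(Φ₀, Φ₁)` -/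

section TwoTypes

variable {K₀ K₁ : Type} [Field K₀] [NumberField K₀] [Field K₁] [NumberField K₁] {Φ₀ : CMType K₀} {Φ₁ : CMType K₁}
  {A₀ A₁ : AbelianVariety ℂ} {ι₀ : 𝓞 K₀ →+* End A₀} {θ₀ : K₀ →+* Module.End ℂ (complexBetti A₀.X 1)}
  {ι₁ : 𝓞 K₁ →+* End A₁} {θ₁ : K₁ →+* Module.End ℂ (complexBetti A₁.X 1)}

/-- **`dim_ℚ Hom_{Hod}(H¹_B(A₁), H¹_B(A₀)) = dim_ℚ Hom_{ℚ-HS}(V¹_{(K₁,Φ₁)}, V¹_{(K₀,Φ₀)})`**: conjugation by the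
isomorphisms `V¹_{Φᵢ} ≅ H¹_B(Aᵢ)` of §1 (`Hom.finrank_eq_of_comp_eq_id`). [cite: GreenGriffithsKerr2012, §V.B p. 160]
[cite: DeligneHodgeII1971, Thm. 2.3.5] -/
theorem IsCMTypeRealisation.finrank_hom_bettiOne_eq_finrank_hom_ofCMType (h₀ : IsCMTypeRealisation Φ₀ A₀ ι₀ θ₀)
    (h₁ : IsCMTypeRealisation Φ₁ A₁ ι₁ θ₁) (B₀ : HodgeModel A₀.dim A₀.X) (hB₀ : B₀.IsHodgeSymmetric)
    (B₁ : HodgeModel A₁.dim A₁.X) (hB₁ : B₁.IsHodgeSymmetric) :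
    finrank ℚ (Hom (bettiOneHodgeStructure A₁ B₁ hB₁) (bettiOneHodgeStructure A₀ B₀ hB₀)) =
      finrank ℚ (Hom (ofCMType Φ₁) (ofCMType Φ₀)) := by
  obtain ⟨f₀, g₀, hgf₀, hfg₀, -⟩ := h₀.exists_hom_ofCMType_bettiOne B₀ hB₀
  obtain ⟨f₁, g₁, hgf₁, hfg₁, -⟩ := h₁.exists_hom_ofCMType_bettiOne B₁ hB₁
  exact HodgeStructure.Hom.finrank_eq_of_comp_eq_id f₀ g₀ hgf₀ hfg₀ f₁ g₁ hgf₁ hfg₁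

/-- **`dim_ℚ Hom_{Hod}(H¹_B(A₁), H¹_B(A₀)) = #C(Φ₀, Φ₁)`** (the character count of
`Motives/HodgeStructureOfCMTypeHomSpaces`, transported). [cite: MilneCM2006, Ch. I §5 Prop. 5.2]
[cite: GreenGriffithsKerr2012, §V.B p. 160] -/
theorem IsCMTypeRealisation.finrank_hom_bettiOne_eq_ncard (h₀ : IsCMTypeRealisation Φ₀ A₀ ι₀ θ₀)
    (h₁ : IsCMTypeRealisation Φ₁ A₁ ι₁ θ₁) (B₀ : HodgeModel A₀.dim A₀.X) (hB₀ : B₀.IsHodgeSymmetric)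
    (B₁ : HodgeModel A₁.dim A₁.X) (hB₁ : B₁.IsHodgeSymmetric) :
    finrank ℚ (Hom (bettiOneHodgeStructure A₁ B₁ hB₁) (bettiOneHodgeStructure A₀ B₀ hB₀)) =
      {q : (K₀ →+* ℂ) × (K₁ →+* ℂ) | ∀ τ : ℂ ≃+* ℂ,
        ((τ : ℂ →+* ℂ).comp q.1 ∈ Φ₀.1 ↔ (τ : ℂ →+* ℂ).comp q.2 ∈ Φ₁.1)}.ncard := by
  rw [h₀.finrank_hom_bettiOne_eq_finrank_hom_ofCMType h₁ B₀ hB₀ B₁ hB₁,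
    HodgeStructure.finrank_hom_ofCMType_eq_ncard]

/-- **THE RANK OF `Hom` BETWEEN TWO CM ABELIAN VARIETIES:
`rk_ℤ Hom(A₀, A₁) = #{(s,t) ∈ Hom(K₀,ℂ) × Hom(K₁,ℂ) | ∀ τ ∈ Aut(ℂ), τ ∘ s ∈ Φ₀ ⟺ τ ∘ t ∈ Φ₁}`** for realisations
`(A₀, ι₀, θ₀)` of `(K₀; Φ₀)` and `(A₁, ι₁, θ₁)` of `(K₁; Φ₁)` — ANY two number fields with complex CM types: Riemann's
theorem (`Hom(A₀, A₁) ⊗ ℚ = Hom_{Hod_ℚ}(H¹_B(A₁), H¹_B(A₀))`, Deligne–Milne 6.20, the tree's `finrank_hom_bettiOne_eq`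
read in Hodge-symmetric models, which exist), `H¹_B(Aᵢ) ≅ V¹_{(Kᵢ,Φᵢ)}` (§1) and the character count (Milne CM
Prop. 5.2; Galois descent). [cite: DeligneMilne1982Tannakian, II §6 Thm. 6.20 (Riemann), p. 212]
[cite: MilneCM2006, Ch. I §5 Prop. 5.2] [cite: GreenGriffithsKerr2012, §V.B p. 160] -/
theorem IsCMTypeRealisation.finrank_hom_eq_ncard (h₀ : IsCMTypeRealisation Φ₀ A₀ ι₀ θ₀)
    (h₁ : IsCMTypeRealisation Φ₁ A₁ ι₁ θ₁) :
    Module.finrank ℤ (A₀ ⟶ A₁) =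
      {q : (K₀ →+* ℂ) × (K₁ →+* ℂ) | ∀ τ : ℂ ≃+* ℂ,
        ((τ : ℂ →+* ℂ).comp q.1 ∈ Φ₀.1 ↔ (τ : ℂ →+* ℂ).comp q.2 ∈ Φ₁.1)}.ncard := by
  obtain ⟨B₀, hB₀⟩ := exists_isReal_hodgeModel_holds.exists_isHodgeSymmetric
    (Motives.AbelianVariety.isSmoothProjective_holds (A := A₀))
  obtain ⟨B₁, hB₁⟩ := exists_isReal_hodgeModel_holds.exists_isHodgeSymmetric
    (Motives.AbelianVariety.isSmoothProjective_holds (A := A₁))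
  rw [← AbelianVariety.finrank_hom_bettiOne_eq B₀ hB₀ B₁ hB₁, h₀.finrank_hom_bettiOne_eq_ncard h₁ B₀ hB₀ B₁ hB₁]

/-- **`dim_ℚ Hom⁰(A₀, A₁) = #C(Φ₀, Φ₁)`** for `Hom⁰ = ℚ ⊗_ℤ Hom` (`Hom(A₀, A₁)` is free, Mumford §19 Thm. 3; the tree's
`finrank_rat_tensor_hom`). [cite: MumfordAV1970, §19 Thm. 3 and Cor. 1]
[cite: DeligneMilne1982Tannakian, II §6 Thm. 6.20 (Riemann), p. 212] [cite: MilneCM2006, Ch. I §5 Prop. 5.2] -/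
theorem IsCMTypeRealisation.finrank_rat_tensor_hom_eq_ncard (h₀ : IsCMTypeRealisation Φ₀ A₀ ι₀ θ₀)
    (h₁ : IsCMTypeRealisation Φ₁ A₁ ι₁ θ₁) :
    finrank ℚ (ℚ ⊗[ℤ] (A₀ ⟶ A₁)) =
      {q : (K₀ →+* ℂ) × (K₁ →+* ℂ) | ∀ τ : ℂ ≃+* ℂ,
        ((τ : ℂ →+* ℂ).comp q.1 ∈ Φ₀.1 ↔ (τ : ℂ →+* ℂ).comp q.2 ∈ Φ₁.1)}.ncard := by
  rw [Motives.AbelianVariety.finrank_rat_tensor_hom, h₀.finrank_hom_eq_ncard h₁]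

/-- **`rk Hom(A₀, A₁) = rk Hom(A₁, A₀)`** for CM abelian varieties (both are the number of compatible pairs, a
symmetric count — `finrank_hom_ofCMType_comm`). [cite: MilneCM2006, Ch. I §5 Prop. 5.2]
[cite: Lange2023AbelianVarietiesComplex, §2.4.4 Cor. 2.4.26] -/
theorem IsCMTypeRealisation.finrank_hom_comm (h₀ : IsCMTypeRealisation Φ₀ A₀ ι₀ θ₀)
    (h₁ : IsCMTypeRealisation Φ₁ A₁ ι₁ θ₁) :
    Module.finrank ℤ (A₀ ⟶ A₁) = Module.finrank ℤ (A₁ ⟶ A₀) := by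
  rw [h₀.finrank_hom_eq_ncard h₁, h₁.finrank_hom_eq_ncard h₀]
  exact (HodgeStructure.finrank_hom_ofCMType_eq_ncard Φ₀ Φ₁).symm.trans
    ((HodgeStructure.finrank_hom_ofCMType_comm Φ₀ Φ₁).trans (HodgeStructure.finrank_hom_ofCMType_eq_ncard Φ₁ Φ₀))

/-- **`Hom(A₀, A₁) = 0` iff NO pair of embeddings is compatible** (`∀ s t, ∃ τ, ¬(τs ∈ Φ₀ ⟺ τt ∈ Φ₁)`): by Riemann's
theorem `Hom(A₀, A₁) = 0 ⟺ Hom_{Hod}(H¹_B(A₁), H¹_B(A₀)) = 0` (the tree's `forall_hom_bettiOne_eq_zero_iff`), and the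
latter has the dimension of `Hom_{ℚ-HS}(V¹_{Φ₁}, V¹_{Φ₀})`, zero iff `C(Φ₀, Φ₁) = ∅`
(`forall_hom_ofCMType_eq_zero_iff`). [cite: DeligneMilne1982Tannakian, II §6 Thm. 6.20 (Riemann), p. 212]
[cite: MilneCM2006, Ch. I §5 Prop. 5.2] -/
theorem IsCMTypeRealisation.forall_hom_eq_zero_iff (h₀ : IsCMTypeRealisation Φ₀ A₀ ι₀ θ₀)
    (h₁ : IsCMTypeRealisation Φ₁ A₁ ι₁ θ₁) :
    (∀ u : A₀ ⟶ A₁, u = 0) ↔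
      ∀ (s : K₀ →+* ℂ) (t : K₁ →+* ℂ), ∃ τ : ℂ ≃+* ℂ,
        ¬ ((τ : ℂ →+* ℂ).comp s ∈ Φ₀.1 ↔ (τ : ℂ →+* ℂ).comp t ∈ Φ₁.1) := by
  obtain ⟨B₀, hB₀⟩ := exists_isReal_hodgeModel_holds.exists_isHodgeSymmetric
    (Motives.AbelianVariety.isSmoothProjective_holds (A := A₀))
  obtain ⟨B₁, hB₁⟩ := exists_isReal_hodgeModel_holds.exists_isHodgeSymmetric
    (Motives.AbelianVariety.isSmoothProjective_holds (A := A₁))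
  haveI := AbelianVariety.finite_hom_bettiOne B₀ hB₀ B₁ hB₁
  haveI := HodgeStructure.finite_hom_ofCMType Φ₀ Φ₁
  rw [← AbelianVariety.forall_hom_bettiOne_eq_zero_iff B₀ hB₀ B₁ hB₁,
    ← HodgeStructure.forall_hom_ofCMType_eq_zero_iff Φ₀ Φ₁, ← finrank_zero_iff_forall_zero (K := ℚ),
    ← finrank_zero_iff_forall_zero (K := ℚ), h₀.finrank_hom_bettiOne_eq_finrank_hom_ofCMType h₁ B₀ hB₀ B₁ hB₁]

/-- **Isogenous CM abelian varieties have a compatible pair of embeddings**: an isogeny `u : A₀ → A₁` is a non-zero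
homomorphism (`u^*` is bijective on `H¹(−(ℂ); ℚ) ≠ 0`, the tree's `isogeny_bettiMap_bijective_holds`), so
`Hom(A₀, A₁) ≠ 0` and `C(Φ₀, Φ₁) ≠ ∅`. [cite: MilneCM2006, Ch. I §3 Prop. 3.12 and §5 Prop. 5.2]
[cite: DeligneMilne1982Tannakian, II §6 Thm. 6.20 (Riemann), p. 212] -/
theorem IsCMTypeRealisation.exists_forall_comp_mem_iff_of_isIsogenous (h₀ : IsCMTypeRealisation Φ₀ A₀ ι₀ θ₀)
    (h₁ : IsCMTypeRealisation Φ₁ A₁ ι₁ θ₁) (hiso : Motives.AbelianVariety.IsIsogenous A₀ A₁) :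
    ∃ (s : K₀ →+* ℂ) (t : K₁ →+* ℂ), ∀ τ : ℂ ≃+* ℂ,
      (τ : ℂ →+* ℂ).comp s ∈ Φ₀.1 ↔ (τ : ℂ →+* ℂ).comp t ∈ Φ₁.1 := by
  obtain ⟨u, hu⟩ := hiso
  by_contra hne
  simp only [not_exists, not_forall] at hne
  have h0 : u = 0 := (h₀.forall_hom_eq_zero_iff h₁).2 hne u
  have hb := isogeny_bettiMap_bijective_holds A₀ A₁ u hu
  subst h0
  rw [bettiCohomology_map_zero_one, ModuleCat.hom_zero] at hb
  -- the zero map `H¹(A₁(ℂ); ℚ) → H¹(A₀(ℂ); ℚ)` is injective only if `H¹(A₁(ℂ); ℚ) = 0`, but `dim = [K₁:ℚ] > 0`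
  have hK : 0 < Module.finrank ℚ (bettiCohomology A₁.X 1) := by
    rw [BettiUniverse.finrank_bettiCohomology_one_eq h₁.1 h₁.2.1]
    exact Module.finrank_pos
  obtain ⟨x, hx⟩ := Module.finrank_pos_iff_exists_ne_zero.1 hK
  exact hx (hb.1 (by rw [LinearMap.zero_apply, LinearMap.zero_apply]))

/-- Contrapositive: **CM abelian varieties without a compatible pair of embeddings are NOT isogenous.**
[cite: MilneCM2006, Ch. I §3 Prop. 3.12 and §5 Prop. 5.2] -/
theorem IsCMTypeRealisation.not_isIsogenous_of_forall (h₀ : IsCMTypeRealisation Φ₀ A₀ ι₀ θ₀)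
    (h₁ : IsCMTypeRealisation Φ₁ A₁ ι₁ θ₁)
    (hC : ∀ (s : K₀ →+* ℂ) (t : K₁ →+* ℂ), ∃ τ : ℂ ≃+* ℂ,
      ¬ ((τ : ℂ →+* ℂ).comp s ∈ Φ₀.1 ↔ (τ : ℂ →+* ℂ).comp t ∈ Φ₁.1)) :
    ¬ Motives.AbelianVariety.IsIsogenous A₀ A₁ := fun hiso => by
  obtain ⟨s, t, hst⟩ := h₀.exists_forall_comp_mem_iff_of_isIsogenous h₁ hiso
  obtain ⟨τ, hτ⟩ := hC s t
  exact hτ (hst τ)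

end TwoTypes

/-! ## §2′ Junction with the CM tori of record: `rk_ℤ Hom(A₀, A₁) = rk Hom_ℚ(ℂ^{Φ₀}/u(𝔪₀), ℂ^{Φ₁}/u(𝔪₁))` -/

section Tori

open scoped Classical
open Literature.Geometry.Kaehler (ComplexTorus.homRat)

variable {K₀ K₁ : Type} [Field K₀] [NumberField K₀] [Field K₁] [NumberField K₁] {Φ₀ : CMType K₀} {Φ₁ : CMType K₁}
  {A₀ A₁ : AbelianVariety ℂ} {ι₀ : 𝓞 K₀ →+* End A₀} {θ₀ : K₀ →+* Module.End ℂ (complexBetti A₀.X 1)}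
  {ι₁ : 𝓞 K₁ →+* End A₁} {θ₁ : K₁ →+* Module.End ℂ (complexBetti A₁.X 1)}
  {κ₀ κ₁ : Type} [Fintype κ₀] [Fintype κ₁] [DecidableEq κ₀] [DecidableEq κ₁]

/-- **`rk_ℤ Hom(A₀, A₁) = rk Hom_ℚ(B₀, B₁)`** for realisations `Aᵢ` of `(Kᵢ; Φᵢ)` on the algebraic carrier and the CM
tori `Bᵢ = ℂ^{Φᵢ}/u(𝔪ᵢ)` (`ComplexTorus (CMTorus.periodEquiv Φᵢ μᵢ)`, ANY lattices `𝔪ᵢ = ⊕ ℤ μᵢ`): both are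
`#C(Φ₀, Φ₁)` (`CMTorus.finrank_homRat_periodEquiv_periodEquiv_eq_ncard`). [cite: MilneCM2006, Ch. I §5 Prop. 5.2]
[cite: Shimura1998, §6.2 Theorem 3] -/
theorem IsCMTypeRealisation.finrank_hom_eq_finrank_homRat_periodEquiv (h₀ : IsCMTypeRealisation Φ₀ A₀ ι₀ θ₀)
    (h₁ : IsCMTypeRealisation Φ₁ A₁ ι₁ θ₁) (μ₀ : Basis κ₀ ℚ K₀) (μ₁ : Basis κ₁ ℚ K₁) :
    Module.finrank ℤ (A₀ ⟶ A₁) =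
      finrank ℚ (ComplexTorus.homRat (CMTorus.periodEquiv Φ₀ μ₀) (CMTorus.periodEquiv Φ₁ μ₁)) := by
  rw [h₀.finrank_hom_eq_ncard h₁, CMTorus.finrank_homRat_periodEquiv_periodEquiv_eq_ncard]

end Tori

/-! ## §3 One type: `rk_ℤ End(A) = dim_ℚ End⁰(A) = #C(Φ, Φ) ≥ [K:ℚ] = 2 dim A` -/

section OneType

variable {K : Type} [Field K] [NumberField K] {Φ : CMType K} {A A' : AbelianVariety ℂ} {ι : 𝓞 K →+* End A}
  {θ : K →+* Module.End ℂ (complexBetti A.X 1)} {ι' : 𝓞 K →+* End A'}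
  {θ' : K →+* Module.End ℂ (complexBetti A'.X 1)}

/-- **`rk_ℤ End(A) = #{(s,t) ∈ Hom(K,ℂ)² | ∀ τ ∈ Aut(ℂ), τ ∘ s ∈ Φ ⟺ τ ∘ t ∈ Φ}`** for a realisation of `(K; Φ)`.
[cite: DeligneMilne1982Tannakian, II §6 Thm. 6.20 (Riemann), p. 212] [cite: MilneCM2006, Ch. I §5 Prop. 5.2]
[cite: Shimura1998, §5.1 Props. 4, 6 and §5.2 p. 39] -/
theorem IsCMTypeRealisation.finrank_end_eq_ncard (h : IsCMTypeRealisation Φ A ι θ) :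
    Module.finrank ℤ (A ⟶ A) =
      {q : (K →+* ℂ) × (K →+* ℂ) | ∀ τ : ℂ ≃+* ℂ,
        ((τ : ℂ →+* ℂ).comp q.1 ∈ Φ.1 ↔ (τ : ℂ →+* ℂ).comp q.2 ∈ Φ.1)}.ncard :=
  h.finrank_hom_eq_ncard h

/-- **`dim_ℚ End⁰(A) = #C(Φ, Φ)`** for the tree's endomorphism algebra `A.endAlgebra = ℚ ⊗_ℤ End A`
(`finrank_endAlgebra_eq_finrank_end`). [cite: MumfordAV1970, §19 Cor. 1–2 of Thm. 3]
[cite: MilneCM2006, Ch. I §5 Prop. 5.2] [cite: Shimura1998, §5.1 Props. 4, 6] -/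
theorem IsCMTypeRealisation.finrank_endAlgebra_eq_ncard (h : IsCMTypeRealisation Φ A ι θ) :
    finrank ℚ A.endAlgebra =
      {q : (K →+* ℂ) × (K →+* ℂ) | ∀ τ : ℂ ≃+* ℂ,
        ((τ : ℂ →+* ℂ).comp q.1 ∈ Φ.1 ↔ (τ : ℂ →+* ℂ).comp q.2 ∈ Φ.1)}.ncard := by
  rw [Motives.AbelianVariety.finrank_endAlgebra_eq_finrank_end, h.finrank_end_eq_ncard]

/-- **Two realisations `A`, `A'` of ONE CM type have `rk_ℤ Hom(A, A') ≥ [K:ℚ]`** (the diagonal pairs `(s, s)` are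
compatible; `finrank_le_finrank_end_ofCMType`) — in particular `Hom(A, A') ≠ 0`, the numerical shadow of Shimura's
«any two abelian varieties of the same CM-type are isogenous». [cite: Shimura1998, §6.1 Corollary of Theorem 2]
[cite: MilneCM2006, Ch. I §5 Prop. 5.2] -/
theorem IsCMTypeRealisation.finrank_le_finrank_hom (h : IsCMTypeRealisation Φ A ι θ)
    (h' : IsCMTypeRealisation Φ A' ι' θ') : finrank ℚ K ≤ Module.finrank ℤ (A ⟶ A') := by
  obtain ⟨B, hB⟩ := exists_isReal_hodgeModel_holds.exists_isHodgeSymmetric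
    (Motives.AbelianVariety.isSmoothProjective_holds (A := A))
  obtain ⟨B', hB'⟩ := exists_isReal_hodgeModel_holds.exists_isHodgeSymmetric
    (Motives.AbelianVariety.isSmoothProjective_holds (A := A'))
  rw [← AbelianVariety.finrank_hom_bettiOne_eq B hB B' hB',
    h.finrank_hom_bettiOne_eq_finrank_hom_ofCMType h' B hB B' hB']
  exact HodgeStructure.finrank_le_finrank_end_ofCMType Φ

/-- **`[K:ℚ] ≤ rk_ℤ End(A)`**. [cite: Shimura1998, §5.1 Props. 4, 6 and §5.2 p. 39] [cite: MilneCM2006, Ch. I §5 Prop. 5.2] -/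
theorem IsCMTypeRealisation.finrank_le_finrank_end (h : IsCMTypeRealisation Φ A ι θ) :
    finrank ℚ K ≤ Module.finrank ℤ (A ⟶ A) :=
  h.finrank_le_finrank_hom h

/-- **`2 dim A ≤ rk_ℤ End(A)`: a realisation of a CM type has complex multiplication in the rank sense**
(`[K:ℚ] = dim H¹ = 2 dim A`). [cite: Shimura1998, §5.2 pp. 36–39 («[F : ℚ] = 2n»)] [cite: MilneCM2006, Ch. I §3 (3.11)] -/
theorem IsCMTypeRealisation.two_mul_dim_le_finrank_end (h : IsCMTypeRealisation Φ A ι θ) :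
    2 * A.dim ≤ Module.finrank ℤ (A ⟶ A) := by
  rw [← finrank_bettiCohomology_one A, BettiUniverse.finrank_bettiCohomology_one_eq h.1 h.2.1]
  exact h.finrank_le_finrank_end

/-- **`[K:ℚ] ≤ dim_ℚ End⁰(A)`**. [cite: Shimura1998, §5.1 Props. 4, 6 and §5.2 p. 39] -/
theorem IsCMTypeRealisation.finrank_le_finrank_endAlgebra (h : IsCMTypeRealisation Φ A ι θ) :
    finrank ℚ K ≤ finrank ℚ A.endAlgebra := by
  rw [Motives.AbelianVariety.finrank_endAlgebra_eq_finrank_end]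
  exact h.finrank_le_finrank_end

/-- `[K:ℚ] = 2` ⟹ `rk_ℤ End(A) = 2` (`finrank_end_ofCMType_eq_two_of_finrank_eq_two`).
[cite: Shimura1998, §5.1 Props. 4, 6 (n = 1)] [cite: MilneCM2006, Ch. I §5 Prop. 5.2] -/
theorem IsCMTypeRealisation.finrank_end_eq_two_of_finrank_eq_two (h : IsCMTypeRealisation Φ A ι θ)
    (h2 : finrank ℚ K = 2) : Module.finrank ℤ (A ⟶ A) = 2 := by
  obtain ⟨B, hB⟩ := exists_isReal_hodgeModel_holds.exists_isHodgeSymmetric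
    (Motives.AbelianVariety.isSmoothProjective_holds (A := A))
  rw [← AbelianVariety.finrank_hom_bettiOne_eq B hB B hB, h.finrank_hom_bettiOne_eq_finrank_hom_ofCMType h B hB B hB]
  exact HodgeStructure.finrank_end_ofCMType_eq_two_of_finrank_eq_two Φ h2

/-- Validation `n = 1`: **a CM elliptic curve (a one-dimensional realisation of a CM type) has `rk_ℤ End(E) = 2`** —
`End(E)` is an order in the imaginary quadratic field `K`, numerically. [cite: Shimura1998, §5.1 Props. 4, 6 (n = 1)]
[cite: MilneCM2006, Ch. I §5 Prop. 5.2] -/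
theorem IsCMTypeRealisation.finrank_end_eq_two_of_dim_eq_one (h : IsCMTypeRealisation Φ A ι θ) (h1 : A.dim = 1) :
    Module.finrank ℤ (A ⟶ A) = 2 := by
  refine h.finrank_end_eq_two_of_finrank_eq_two ?_
  rw [← BettiUniverse.finrank_bettiCohomology_one_eq h.1 h.2.1, finrank_bettiCohomology_one A, h1]

end OneType

end Literature.AlgebraicGeometry.ComplexMultiplication

end
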